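import Literature.NumberTheory.EllipticCurves.Kato2004.EulerSystemValues
import Literature.NumberTheory.EllipticCurves.KatoTwistedFinitenessEulerFactorsProofs
import Literature.NumberTheory.EllipticCurves.PAdicLFunctionNeZeroHoldsProofs
import Literature.NumberTheory.EllipticCurves.PAdicLFunctionMinus
import Literature.NumberTheory.LFunctions.DirichletLValueBernoulli
import HarnessLib

set_option linter.dupNamespace false

/-!
# The depletion-at-`s = 1` glue for the value law (C5) of Kato's `ZetaBody` on crux `CccOneLawOnTypeIstarZero`
# (stmt-BirchSwinnertonDyer-19223, route `InertBadSignedBranches`) — refill hand `leafhand-bsd-inertbadsignedbran-10` g0, file 1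

Def-free helper file (theorems only; `--supports stmt-BirchSwinnertonDyer-19223`), docket (P1) of host bsd-eis-plan g43
(eis STATUS l.8307) = item 2 of the «What is missing» list of ibsb-9's census (19223 evidence #47): the value AT `s = 1` of a
DEPLETED continuation against the value of the un-depleted / primitive continuation.

Kato's value law (C5) of `Kato2004.ZetaBody` (Thm. 9.7 ∘ Thm. 6.6 (1)) prices the character sum of the Euler-system value
`x_{k,r}` by `L 1`, `L` ANY entire continuation of the `S`-DEPLETED twisted series `L_S(f, χ, s) = Σ_{(n, m·p·A) = 1} a_n χ(n) n^{-s}`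
(`Kato2004.EulerSystemValues.IsDepletedTwistedL f m (p·A) χ L`: `L` entire, `= twistedLSeries f (changeLevel χ)` on `Re s > 2`),
while Birch's formula (tree `ratTwistedSymbolSum_mul_plusPeriod_holds`, `ratMinusTwistedSymbolSum_mul_minusPeriod_mul_I`) prices
the twisted symbol sums by `L 1` for ANY entire continuation of the PRIMITIVE series `Σ a_n χ̄(n) n^{-s}`.  The tree already holds
the Dirichlet-series identity on `Re s > 2` (`twistedLSeries_changeLevel_eq_prod_mul`, Kato §6.2 / Shimura Thm. 3.66) and uses the
identity theorem INSIDE `exists_continuation_of_changeLevel` (exported only as an `∃ …, L 1 ≠ 0` transfer); this file exports the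
VALUE identity itself, frame-agnostic (no embedding, no root of unity):
* §1 the identity theorem on the half-plane `Re s > 2`: entire continuations of a twisted `L`-series are unique
  (`continuation_unique`), depleted continuations are unique (`isDepletedTwistedL_unique`);
* §2 ★ `eq_eulerFactors_mul_of_isDepletedTwistedL`: for a newform `f`, ANY `M`-depleted continuation `L` of `χ` mod `m` and ANY
  entire continuation `L₀` of the mod-`m` series, `L = P · L₀` with
  `P(s) = ∏_{ℓ ∣ mM, ℓ ∤ m} (1 − χ(ℓ)a_ℓ ℓ^{-s} + 𝟙_N(ℓ)χ(ℓ)² ℓ·ℓ^{-2s})` (tree bytes), hence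
  `L 1 = P(1) · L₀ 1` (`isDepletedTwistedL_apply_one_eq`, and `…_eq'` with `P(1) = ∏ (1 − χ(ℓ)a_ℓ/ℓ + 𝟙_N(ℓ)χ(ℓ)²/ℓ)`); the
  same through a divisor `m₀ ∣ m` of the modulus (`…_of_changeLevel`) and through the PRIMITIVE character
  (`eq_eulerFactors_mul_primitive_of_isDepletedTwistedL`, product over `ℓ ∣ mM, ℓ ∤ cond χ`); the un-depleted level change
  (`continuation_eq_eulerFactors_mul_of_changeLevel`); and, for the newform of an elliptic curve, the pointwise transfer
  `L 1 ≠ 0 ↔ L₀ 1 ≠ 0` (`isDepletedTwistedL_apply_one_ne_zero_iff`, removed Euler factors `≠ 0` at `1`, tree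
  `eulerFactors_one_ne_zero`);
* §3 ★ DEPLETED BIRCH, both parities: `f` a rational newform, `χ` PRIMITIVE mod `m`, `L` ANY `M`-depleted continuation of `χ̄`:
  `τ(χ) · L 1 = P_{χ̄}(1) · (Σ_a χ(a)[a/m]⁺_f) · Ω⁺_f` for even `χ` (`gaussSum_mul_apply_one_eq_of_even`),
  `τ(χ) · L 1 = P_{χ̄}(1) · (Σ_a χ(a)[a/m]⁻_f) · Ω⁻_f · i` for odd `χ` (`…_of_odd`), and the (C5)-currency quotients
  `L 1 / Ω⁺_f = P_{χ̄}(1) · (Σ_a χ(a)[a/m]⁺_f) / τ(χ)`, `L 1 / (i Ω⁻_f) = P_{χ̄}(1) · (Σ_a χ(a)[a/m]⁻_f) / τ(χ)` (`τ(χ) ≠ 0`, tree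
  `Literature.NumberTheory.LFunctions.gaussSum_ne_zero`).
No overlap with p836061/p836259/p836361/p836813 (ibsb-9), with `KatoDescentKatoRigidDepletedValues` (which proves only that `P · L₀`
IS a depleted continuation) or with k-ty1 g40's W2 §5 (`isDepletedTwistedL_succ` re-levels the character, no value identity).
HONEST LABEL: helper lemmas; no stub of the istar skeleton is targeted or closed; nothing about 2c-T1, 19223, X12 or BSD is proved;
19223 OPEN; BSD is proved for no curve.
References: [Kato2004Asterisque] §6.2 (p. 161), Thm. 6.6 (1) (p. 163), Thm. 9.7 (p. 189); [Shimura1971] Thm. 3.66;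
[MazurTateTeitelbaum1986Invent] §I.8 (8.6); [Apostol1976] Thm. 8.15.
-/

noncomputable section

open scoped BigOperators
open Complex CongruenceSubgroup
open Literature.NumberTheory.EllipticCurves Literature.NumberTheory.EllipticCurves.ModularForms
open Literature.NumberTheory.EllipticCurves.Kato2004 Literature.NumberTheory.EllipticCurves.Kato2004.EulerSystemValues

namespace Summit.BirchSwinnertonDyer.BirchSwinnertonDyer.Theorems.CccOneDepletedValueGlue

/-! ## §1 The identity theorem on the half-plane of absolute convergence -/

section Identity

/-- **Identity theorem on a right half-plane**: two entire functions that agree on `{s | c < Re s}` are equal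
(the half-plane is open and non-empty, `ℂ` is connected). [folklore] -/
theorem eq_of_differentiable_of_eqOn_re {F G : ℂ → ℂ} (hF : Differentiable ℂ F) (hG : Differentiable ℂ G)
    {c : ℝ} (h : ∀ s : ℂ, c < s.re → F s = G s) : F = G := by
  refine AnalyticOnNhd.eq_of_eventuallyEq (z₀ := ((c + 1 : ℝ) : ℂ))
    (hF.differentiableOn.analyticOnNhd isOpen_univ)
    (hG.differentiableOn.analyticOnNhd isOpen_univ) ?_
  have hopen : IsOpen {s : ℂ | c < s.re} := isOpen_lt continuous_const Complex.continuous_re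
  have hmem : ((c + 1 : ℝ) : ℂ) ∈ {s : ℂ | c < s.re} := by
    simp only [Set.mem_setOf_eq, Complex.ofReal_re]
    linarith
  filter_upwards [hopen.mem_nhds hmem] with s hs using h s hs

/-- **The entire continuation of a twisted `L`-series is unique**: two entire functions agreeing with
`twistedLSeries f χ` on `Re s > 2` are equal (Shimura 1971, Thm. 3.66: the continuation exists; uniqueness by the
identity theorem). [cite: Shimura1971, Thm. 3.66] -/
theorem continuation_unique {N : ℕ} {k : ℤ} (f : CuspForm (Gamma0 N) k) {m : ℕ} (χ : DirichletCharacter ℂ m)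
    {L₁ L₂ : ℂ → ℂ} (h₁ : Differentiable ℂ L₁) (h₁' : ∀ s : ℂ, 2 < s.re → L₁ s = twistedLSeries f χ s)
    (h₂ : Differentiable ℂ L₂) (h₂' : ∀ s : ℂ, 2 < s.re → L₂ s = twistedLSeries f χ s) : L₁ = L₂ :=
  eq_of_differentiable_of_eqOn_re h₁ h₂ fun s hs => by rw [h₁' s hs, h₂' s hs]

/-- **Kato's depleted continuation is unique**: two `M`-depleted continuations of the twisted series of `χ` mod `m`
(`IsDepletedTwistedL f m M χ`, Kato §6.2: `L_S(f, χ, s)`, `S = prime(mM)`) are equal. [cite: Kato2004Asterisque, §6.2 (p. 161)] -/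
theorem isDepletedTwistedL_unique {N : ℕ} (f : CuspForm (Gamma0 N) 2) {m M : ℕ} (χ : DirichletCharacter ℂ m)
    {L₁ L₂ : ℂ → ℂ} (h₁ : IsDepletedTwistedL f m M χ L₁) (h₂ : IsDepletedTwistedL f m M χ L₂) : L₁ = L₂ :=
  continuation_unique f _ h₁.1 h₁.2 h₂.1 h₂.2

end Identity

/-! ## §2 A depleted continuation is the Euler-factor multiple of the mod-`m` continuation; its value at `1` -/

section Glue

variable {N : ℕ} [NeZero N] {f : CuspForm (Gamma0 N) 2}

/-- **The un-depleted level change, as an identity of continuations** (the step buried in the tree's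
`exists_continuation_of_changeLevel`, exported): for a newform `f`, `χ₀` mod `m₀ ∣ m`, ANY entire continuation `L` of the
mod-`m` series of the inflation `changeLevel χ₀` and ANY entire continuation `L₀` of the mod-`m₀` series of `χ₀`,
`L = P · L₀` with `P(s) = ∏_{ℓ ∣ m, ℓ ∤ m₀} (1 − χ₀(ℓ)a_ℓ ℓ^{-s} + 𝟙_N(ℓ)χ₀(ℓ)² ℓ·ℓ^{-2s})` (Kato §6.2; Shimura Thm. 3.66; identity theorem).
[cite: Kato2004Asterisque, §6.2 (p. 161)] [cite: Shimura1971, Thm. 3.66] -/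
theorem continuation_eq_eulerFactors_mul_of_changeLevel (hf : IsNewform0 f) {m₀ m : ℕ} [NeZero m]
    (hm : m₀ ∣ m) (χ₀ : DirichletCharacter ℂ m₀) {L L₀ : ℂ → ℂ} (hLd : Differentiable ℂ L)
    (hLs : ∀ s : ℂ, 2 < s.re → L s = twistedLSeries f (DirichletCharacter.changeLevel hm χ₀) s)
    (hd : Differentiable ℂ L₀) (hs : ∀ s : ℂ, 2 < s.re → L₀ s = twistedLSeries f χ₀ s) :
    L = fun s => (∏ ℓ ∈ m.primeFactors.filter (fun ℓ => ¬ ℓ ∣ m₀),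
      (1 - χ₀ (ℓ : ZMod m₀) * cuspCoeff f ℓ * (ℓ : ℂ) ^ (-s) +
        (if ℓ ∣ N then 0 else (ℓ : ℂ)) * χ₀ (ℓ : ZMod m₀) ^ 2 * ((ℓ : ℂ) ^ (-s)) ^ 2)) * L₀ s := by
  have hPd := differentiable_eulerFactors f χ₀ (S := m.primeFactors.filter (fun ℓ => ¬ ℓ ∣ m₀))
    (fun ℓ hℓ => Nat.prime_of_mem_primeFactors (Finset.mem_filter.mp hℓ).1)
  refine eq_of_differentiable_of_eqOn_re hLd (hPd.mul hd) (c := 2) fun s hs2 => ?_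
  rw [hLs s hs2, hs s hs2, twistedLSeries_changeLevel_eq_prod_mul hf hm χ₀ hs2]

/-- ★ **A depleted continuation IS the Euler-factor multiple of the mod-`m` continuation.** For a newform `f`, a Dirichlet
character `χ` mod `m`, ANY `M`-depleted continuation `L` (`IsDepletedTwistedL f m M χ L`, Kato's `L_S(f, χ, s)`, `S = prime(mM)`)
and ANY entire continuation `L₀` of the mod-`m` series `Σ a_n χ(n) n^{-s}`:
`L = P · L₀`, `P(s) = ∏_{ℓ ∣ mM, ℓ ∤ m} (1 − χ(ℓ)a_ℓ ℓ^{-s} + 𝟙_N(ℓ)χ(ℓ)² ℓ·ℓ^{-2s})` (tree `twistedLSeries_changeLevel_eq_prod_mul` on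
`Re s > 2`, then the identity theorem). [cite: Kato2004Asterisque, §6.2 (p. 161)] [cite: Shimura1971, Thm. 3.66] -/
theorem eq_eulerFactors_mul_of_isDepletedTwistedL (hf : IsNewform0 f) {m M : ℕ} [NeZero m] [NeZero M]
    (χ : DirichletCharacter ℂ m) {L L₀ : ℂ → ℂ} (hL : IsDepletedTwistedL f m M χ L)
    (hd : Differentiable ℂ L₀) (hs : ∀ s : ℂ, 2 < s.re → L₀ s = twistedLSeries f χ s) :
    L = fun s => (∏ ℓ ∈ (m * M).primeFactors.filter (fun ℓ => ¬ ℓ ∣ m),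
      (1 - χ (ℓ : ZMod m) * cuspCoeff f ℓ * (ℓ : ℂ) ^ (-s) +
        (if ℓ ∣ N then 0 else (ℓ : ℂ)) * χ (ℓ : ZMod m) ^ 2 * ((ℓ : ℂ) ^ (-s)) ^ 2)) * L₀ s := by
  haveI : NeZero (m * M) := ⟨mul_ne_zero (NeZero.ne m) (NeZero.ne M)⟩
  exact continuation_eq_eulerFactors_mul_of_changeLevel hf (dvd_mul_right m M) χ hL.1 hL.2 hd hs

/-- **Pointwise form**: `L s = P(s) · L₀ s` for every `s ∈ ℂ`. [cite: Kato2004Asterisque, §6.2 (p. 161)] -/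
theorem isDepletedTwistedL_apply_eq (hf : IsNewform0 f) {m M : ℕ} [NeZero m] [NeZero M]
    (χ : DirichletCharacter ℂ m) {L L₀ : ℂ → ℂ} (hL : IsDepletedTwistedL f m M χ L)
    (hd : Differentiable ℂ L₀) (hs : ∀ s : ℂ, 2 < s.re → L₀ s = twistedLSeries f χ s) (s : ℂ) :
    L s = (∏ ℓ ∈ (m * M).primeFactors.filter (fun ℓ => ¬ ℓ ∣ m),
      (1 - χ (ℓ : ZMod m) * cuspCoeff f ℓ * (ℓ : ℂ) ^ (-s) +
        (if ℓ ∣ N then 0 else (ℓ : ℂ)) * χ (ℓ : ZMod m) ^ 2 * ((ℓ : ℂ) ^ (-s)) ^ 2)) * L₀ s :=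
  congr_fun (eq_eulerFactors_mul_of_isDepletedTwistedL hf χ hL hd hs) s

/-- ★ **The depleted value at `s = 1`**: `L 1 = P(1) · L₀ 1`,
`P(1) = ∏_{ℓ ∣ mM, ℓ ∤ m} (1 − χ(ℓ)a_ℓ ℓ^{-1} + 𝟙_N(ℓ)χ(ℓ)² ℓ·(ℓ^{-1})²)` (the tree's bytes for the removed Euler factors at `1`,
as in `eulerFactors_one_ne_zero`). [cite: Kato2004Asterisque, §6.2 (p. 161)] -/
theorem isDepletedTwistedL_apply_one_eq (hf : IsNewform0 f) {m M : ℕ} [NeZero m] [NeZero M]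
    (χ : DirichletCharacter ℂ m) {L L₀ : ℂ → ℂ} (hL : IsDepletedTwistedL f m M χ L)
    (hd : Differentiable ℂ L₀) (hs : ∀ s : ℂ, 2 < s.re → L₀ s = twistedLSeries f χ s) :
    L 1 = (∏ ℓ ∈ (m * M).primeFactors.filter (fun ℓ => ¬ ℓ ∣ m),
      (1 - χ (ℓ : ZMod m) * cuspCoeff f ℓ * (ℓ : ℂ) ^ (-(1 : ℂ)) +
        (if ℓ ∣ N then 0 else (ℓ : ℂ)) * χ (ℓ : ZMod m) ^ 2 * ((ℓ : ℂ) ^ (-(1 : ℂ))) ^ 2)) * L₀ 1 :=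
  isDepletedTwistedL_apply_eq hf χ hL hd hs 1

omit [NeZero N] in
/-- The removed Euler factor at `1`, cleaned: `1 − χ(ℓ)a_ℓ ℓ^{-1} + 𝟙_N(ℓ)χ(ℓ)² ℓ·(ℓ^{-1})² = 1 − χ(ℓ)a_ℓ/ℓ + 𝟙_N(ℓ)χ(ℓ)²/ℓ`
for a prime (indeed any non-zero natural number) `ℓ`. [folklore] -/
theorem eulerFactor_one_eq {m : ℕ} (χ : DirichletCharacter ℂ m) {ℓ : ℕ} (hℓ : ℓ ≠ 0) :
    (1 - χ (ℓ : ZMod m) * cuspCoeff f ℓ * (ℓ : ℂ) ^ (-(1 : ℂ)) +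
        (if ℓ ∣ N then 0 else (ℓ : ℂ)) * χ (ℓ : ZMod m) ^ 2 * ((ℓ : ℂ) ^ (-(1 : ℂ))) ^ 2) =
      1 - χ (ℓ : ZMod m) * cuspCoeff f ℓ / ℓ + (if ℓ ∣ N then 0 else χ (ℓ : ZMod m) ^ 2 / ℓ) := by
  have hℓ' : (ℓ : ℂ) ≠ 0 := Nat.cast_ne_zero.mpr hℓ
  rw [cpow_neg_one]
  split_ifs with hN
  · simp [div_eq_mul_inv]
  · field_simp

omit [NeZero N] in
/-- The product of removed Euler factors at `1`, cleaned factor by factor over a set of primes. [folklore] -/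
theorem eulerFactors_one_eq {m : ℕ} (χ : DirichletCharacter ℂ m) {S : Finset ℕ} (hS : ∀ ℓ ∈ S, ℓ.Prime) :
    (∏ ℓ ∈ S, (1 - χ (ℓ : ZMod m) * cuspCoeff f ℓ * (ℓ : ℂ) ^ (-(1 : ℂ)) +
        (if ℓ ∣ N then 0 else (ℓ : ℂ)) * χ (ℓ : ZMod m) ^ 2 * ((ℓ : ℂ) ^ (-(1 : ℂ))) ^ 2)) =
      ∏ ℓ ∈ S, (1 - χ (ℓ : ZMod m) * cuspCoeff f ℓ / ℓ + (if ℓ ∣ N then 0 else χ (ℓ : ZMod m) ^ 2 / ℓ)) :=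
  Finset.prod_congr rfl fun ℓ hℓ => eulerFactor_one_eq χ (hS ℓ hℓ).ne_zero

/-- ★ **The depleted value at `s = 1`, cleaned form**: `L 1 = (∏_{ℓ ∣ mM, ℓ ∤ m} (1 − χ(ℓ)a_ℓ/ℓ + 𝟙_N(ℓ)χ(ℓ)²/ℓ)) · L₀ 1`.
[cite: Kato2004Asterisque, §6.2 (p. 161)] -/
theorem isDepletedTwistedL_apply_one_eq' (hf : IsNewform0 f) {m M : ℕ} [NeZero m] [NeZero M]
    (χ : DirichletCharacter ℂ m) {L L₀ : ℂ → ℂ} (hL : IsDepletedTwistedL f m M χ L)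
    (hd : Differentiable ℂ L₀) (hs : ∀ s : ℂ, 2 < s.re → L₀ s = twistedLSeries f χ s) :
    L 1 = (∏ ℓ ∈ (m * M).primeFactors.filter (fun ℓ => ¬ ℓ ∣ m),
      (1 - χ (ℓ : ZMod m) * cuspCoeff f ℓ / ℓ + (if ℓ ∣ N then 0 else χ (ℓ : ZMod m) ^ 2 / ℓ))) * L₀ 1 := by
  rw [isDepletedTwistedL_apply_one_eq hf χ hL hd hs, eulerFactors_one_eq χ
    (fun ℓ hℓ => Nat.prime_of_mem_primeFactors (Finset.mem_filter.mp hℓ).1)]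

/-- **Through a divisor of the modulus.** For a newform `f`, `χ₀` mod `m₀ ∣ m`, ANY `M`-depleted continuation `L` of the
inflation `changeLevel χ₀` mod `m` and ANY entire continuation `L₀` of the mod-`m₀` series of `χ₀`:
`L = P · L₀` with `P(s) = ∏_{ℓ ∣ mM, ℓ ∤ m₀} (1 − χ₀(ℓ)a_ℓ ℓ^{-s} + 𝟙_N(ℓ)χ₀(ℓ)² ℓ·ℓ^{-2s})` (`changeLevel` is transitive).
[cite: Kato2004Asterisque, §6.2 (p. 161)] [cite: Shimura1971, Thm. 3.66] -/
theorem eq_eulerFactors_mul_of_isDepletedTwistedL_changeLevel (hf : IsNewform0 f) {m₀ m M : ℕ} [NeZero m]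
    [NeZero M] (hm : m₀ ∣ m) (χ₀ : DirichletCharacter ℂ m₀) {L L₀ : ℂ → ℂ}
    (hL : IsDepletedTwistedL f m M (DirichletCharacter.changeLevel hm χ₀) L)
    (hd : Differentiable ℂ L₀) (hs : ∀ s : ℂ, 2 < s.re → L₀ s = twistedLSeries f χ₀ s) :
    L = fun s => (∏ ℓ ∈ (m * M).primeFactors.filter (fun ℓ => ¬ ℓ ∣ m₀),
      (1 - χ₀ (ℓ : ZMod m₀) * cuspCoeff f ℓ * (ℓ : ℂ) ^ (-s) +
        (if ℓ ∣ N then 0 else (ℓ : ℂ)) * χ₀ (ℓ : ZMod m₀) ^ 2 * ((ℓ : ℂ) ^ (-s)) ^ 2)) * L₀ s := by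
  haveI : NeZero (m * M) := ⟨mul_ne_zero (NeZero.ne m) (NeZero.ne M)⟩
  have hLs : ∀ s : ℂ, 2 < s.re →
      L s = twistedLSeries f (DirichletCharacter.changeLevel (dvd_trans hm (dvd_mul_right m M)) χ₀) s := by
    intro s hs2
    rw [hL.2 s hs2, ← DirichletCharacter.changeLevel_trans]
  exact continuation_eq_eulerFactors_mul_of_changeLevel hf (dvd_trans hm (dvd_mul_right m M)) χ₀ hL.1 hLs hd hs

/-- **Through the primitive character.** For a newform `f`, a Dirichlet character `χ` mod `m` with primitive character `χ⋆`
(Mathlib `primitiveCharacter`, conductor `cond χ ∣ m`), ANY `M`-depleted continuation `L` of `χ` and ANY entire continuation `L₀`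
of the primitive series `Σ a_n χ⋆(n) n^{-s} = L(f ⊗ χ⋆, s)`:
`L = P · L₀`, `P(s) = ∏_{ℓ ∣ mM, ℓ ∤ cond χ} (1 − χ⋆(ℓ)a_ℓ ℓ^{-s} + 𝟙_N(ℓ)χ⋆(ℓ)² ℓ·ℓ^{-2s})`.
[cite: Kato2004Asterisque, §6.2 (p. 161)] [cite: Shimura1971, Thm. 3.66] -/
theorem eq_eulerFactors_mul_primitive_of_isDepletedTwistedL (hf : IsNewform0 f) {m M : ℕ} [NeZero m]
    [NeZero M] (χ : DirichletCharacter ℂ m) {L L₀ : ℂ → ℂ} (hL : IsDepletedTwistedL f m M χ L)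
    (hd : Differentiable ℂ L₀) (hs : ∀ s : ℂ, 2 < s.re → L₀ s = twistedLSeries f χ.primitiveCharacter s) :
    L = fun s => (∏ ℓ ∈ (m * M).primeFactors.filter (fun ℓ => ¬ ℓ ∣ χ.conductor),
      (1 - χ.primitiveCharacter (ℓ : ZMod χ.conductor) * cuspCoeff f ℓ * (ℓ : ℂ) ^ (-s) +
        (if ℓ ∣ N then 0 else (ℓ : ℂ)) * χ.primitiveCharacter (ℓ : ZMod χ.conductor) ^ 2 *
          ((ℓ : ℂ) ^ (-s)) ^ 2)) * L₀ s := by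
  have hL' : IsDepletedTwistedL f m M
      (DirichletCharacter.changeLevel χ.conductor_dvd_level χ.primitiveCharacter) L := by
    rwa [DirichletCharacter.changeLevel_primitiveCharacter]
  exact eq_eulerFactors_mul_of_isDepletedTwistedL_changeLevel hf χ.conductor_dvd_level χ.primitiveCharacter
    hL' hd hs

/-- **The depleted value at `1` through the primitive value**:
`L 1 = (∏_{ℓ ∣ mM, ℓ ∤ cond χ} (1 − χ⋆(ℓ)a_ℓ ℓ^{-1} + 𝟙_N(ℓ)χ⋆(ℓ)² ℓ·(ℓ^{-1})²)) · L₀ 1`, `L₀` any entire continuation of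
`L(f ⊗ χ⋆, s)`. [cite: Kato2004Asterisque, §6.2 (p. 161)] -/
theorem isDepletedTwistedL_apply_one_eq_primitive (hf : IsNewform0 f) {m M : ℕ} [NeZero m] [NeZero M]
    (χ : DirichletCharacter ℂ m) {L L₀ : ℂ → ℂ} (hL : IsDepletedTwistedL f m M χ L)
    (hd : Differentiable ℂ L₀) (hs : ∀ s : ℂ, 2 < s.re → L₀ s = twistedLSeries f χ.primitiveCharacter s) :
    L 1 = (∏ ℓ ∈ (m * M).primeFactors.filter (fun ℓ => ¬ ℓ ∣ χ.conductor),
      (1 - χ.primitiveCharacter (ℓ : ZMod χ.conductor) * cuspCoeff f ℓ * (ℓ : ℂ) ^ (-(1 : ℂ)) +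
        (if ℓ ∣ N then 0 else (ℓ : ℂ)) * χ.primitiveCharacter (ℓ : ZMod χ.conductor) ^ 2 *
          ((ℓ : ℂ) ^ (-(1 : ℂ))) ^ 2)) * L₀ 1 :=
  congr_fun (eq_eulerFactors_mul_primitive_of_isDepletedTwistedL hf χ hL hd hs) 1

/-- ★ **Non-vanishing at `1` is the same for the depleted and the un-depleted continuation** (pointwise form of the tree's
`exists_continuation_changeLevel_iff`): for the newform `f` of an elliptic curve `E/ℚ`, ANY `M`-depleted continuation `L` of `χ`
mod `m` and ANY entire continuation `L₀` of the mod-`m` series, `L 1 ≠ 0 ↔ L₀ 1 ≠ 0` — the removed Euler factors do not vanish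
at `1` (`|a_ℓ| ≤ 2√ℓ`, resp. `|a_ℓ| < ℓ` at `ℓ ∣ N`; tree `eulerFactors_one_ne_zero`).
[cite: Kato2004Asterisque, §14 Thm. 14.2 (p. 235)] -/
theorem isDepletedTwistedL_apply_one_ne_zero_iff {W : WeierstrassCurve ℚ} [W.IsElliptic] (hf : IsNewformOf W f)
    {m M : ℕ} [NeZero m] [NeZero M] (χ : DirichletCharacter ℂ m) {L L₀ : ℂ → ℂ}
    (hL : IsDepletedTwistedL f m M χ L) (hd : Differentiable ℂ L₀)
    (hs : ∀ s : ℂ, 2 < s.re → L₀ s = twistedLSeries f χ s) : L 1 ≠ 0 ↔ L₀ 1 ≠ 0 := by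
  rw [isDepletedTwistedL_apply_one_eq hf.1 χ hL hd hs]
  have hP := eulerFactors_one_ne_zero hf χ (S := (m * M).primeFactors.filter (fun ℓ => ¬ ℓ ∣ m))
    (fun ℓ hℓ => ⟨Nat.prime_of_mem_primeFactors (Finset.mem_filter.mp hℓ).1, (Finset.mem_filter.mp hℓ).2⟩)
  exact mul_ne_zero_iff.trans (and_iff_right hP)

/-- **The depleted value vanishes iff the un-depleted one does** (contrapositive currency, as used by the Rohrlich-type
finiteness arguments of the tree). [cite: Kato2004Asterisque, §14 Thm. 14.2 (p. 235)] -/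
theorem isDepletedTwistedL_apply_one_eq_zero_iff {W : WeierstrassCurve ℚ} [W.IsElliptic] (hf : IsNewformOf W f)
    {m M : ℕ} [NeZero m] [NeZero M] (χ : DirichletCharacter ℂ m) {L L₀ : ℂ → ℂ}
    (hL : IsDepletedTwistedL f m M χ L) (hd : Differentiable ℂ L₀)
    (hs : ∀ s : ℂ, 2 < s.re → L₀ s = twistedLSeries f χ s) : L 1 = 0 ↔ L₀ 1 = 0 := by
  have h := isDepletedTwistedL_apply_one_ne_zero_iff hf χ hL hd hs
  tauto

end Glue

/-! ## §3 Depleted Birch formulas (both parities) and the (C5)-currency quotients -/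

section Birch

variable {N : ℕ} [NeZero N] {f : CuspForm (Gamma0 N) 2}

/-- ★ **Depleted Birch formula, even parity.** For a rational newform `f` (`IsNewform0 f`, `coeffField f = ⊥`), an EVEN
PRIMITIVE Dirichlet character `χ` mod `m` and ANY `M`-depleted continuation `L` of the series of `χ̄ = χ⁻¹`
(`IsDepletedTwistedL f m M χ⁻¹ L`, Kato's `L_S(f, χ̄, s)`):
`τ(χ) · L 1 = P_{χ̄}(1) · (Σ_{a mod m} χ(a)[a/m]⁺_f) · Ω⁺_f`, `P_{χ̄}(1) = ∏_{ℓ ∣ mM, ℓ ∤ m}(1 − χ̄(ℓ)a_ℓ ℓ^{-1} + 𝟙_N(ℓ)χ̄(ℓ)² ℓ·(ℓ^{-1})²)`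
(Birch's formula, tree `ratTwistedSymbolSum_mul_plusPeriod_holds`, for the un-depleted continuation, and §2).
[cite: MazurTateTeitelbaum1986Invent, §I.8 (8.6)] [cite: Kato2004Asterisque, §6.2 (p. 161)] -/
theorem gaussSum_mul_apply_one_eq_of_even (hf : IsNewform0 f) (hQ : coeffField f = ⊥) {m M : ℕ} [NeZero m]
    [NeZero M] {χ : DirichletCharacter ℂ m} (hχ : χ.IsPrimitive) (hχe : χ.Even) {L : ℂ → ℂ}
    (hL : IsDepletedTwistedL f m M χ⁻¹ L) :
    gaussSum χ (ZMod.stdAddChar (N := m)) * L 1 =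
      (∏ ℓ ∈ (m * M).primeFactors.filter (fun ℓ => ¬ ℓ ∣ m),
        (1 - χ⁻¹ (ℓ : ZMod m) * cuspCoeff f ℓ * (ℓ : ℂ) ^ (-(1 : ℂ)) +
          (if ℓ ∣ N then 0 else (ℓ : ℂ)) * χ⁻¹ (ℓ : ZMod m) ^ 2 * ((ℓ : ℂ) ^ (-(1 : ℂ))) ^ 2)) *
        (ratTwistedSymbolSum f χ * (plusPeriod f : ℂ)) := by
  obtain ⟨L₀, hd, hs⟩ := exists_differentiable_eq_twistedLSeries_holds f χ⁻¹
  rw [isDepletedTwistedL_apply_one_eq hf χ⁻¹ hL hd hs, ratTwistedSymbolSum_mul_plusPeriod_holds hf hQ hχ hχe hd hs]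
  ring

/-- ★ **Depleted Birch formula, odd parity.** Same, for an ODD PRIMITIVE `χ` mod `m` and ANY `M`-depleted continuation `L` of
the series of `χ̄`: `τ(χ) · L 1 = P_{χ̄}(1) · (Σ_{a mod m} χ(a)[a/m]⁻_f) · Ω⁻_f · i`
(tree `ratMinusTwistedSymbolSum_mul_minusPeriod_mul_I` and §2).
[cite: MazurTateTeitelbaum1986Invent, §I.8 (8.6)] [cite: Kato2004Asterisque, §6.2 (p. 161)] -/
theorem gaussSum_mul_apply_one_eq_of_odd (hf : IsNewform0 f) (hQ : coeffField f = ⊥) {m M : ℕ} [NeZero m]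
    [NeZero M] {χ : DirichletCharacter ℂ m} (hχ : χ.IsPrimitive) (hχo : χ.Odd) {L : ℂ → ℂ}
    (hL : IsDepletedTwistedL f m M χ⁻¹ L) :
    gaussSum χ (ZMod.stdAddChar (N := m)) * L 1 =
      (∏ ℓ ∈ (m * M).primeFactors.filter (fun ℓ => ¬ ℓ ∣ m),
        (1 - χ⁻¹ (ℓ : ZMod m) * cuspCoeff f ℓ * (ℓ : ℂ) ^ (-(1 : ℂ)) +
          (if ℓ ∣ N then 0 else (ℓ : ℂ)) * χ⁻¹ (ℓ : ZMod m) ^ 2 * ((ℓ : ℂ) ^ (-(1 : ℂ))) ^ 2)) *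
        (ratMinusTwistedSymbolSum f χ * (minusPeriod f : ℂ) * Complex.I) := by
  obtain ⟨L₀, hd, hs⟩ := exists_differentiable_eq_twistedLSeries_holds f χ⁻¹
  rw [isDepletedTwistedL_apply_one_eq hf χ⁻¹ hL hd hs,
    ratMinusTwistedSymbolSum_mul_minusPeriod_mul_I f hf hQ hχ hχo hd hs]
  ring

/-- **(C5)-currency, even parity**: `L 1 / Ω⁺_f = P_{χ̄}(1) · (Σ_a χ(a)[a/m]⁺_f) / τ(χ)` for ANY `M`-depleted continuation `L` of
the series of `χ̄`, `χ` even primitive mod `m`, `Ω⁺_f ≠ 0` (`τ(χ) ≠ 0` for a primitive `χ`, tree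
`Literature.NumberTheory.LFunctions.gaussSum_ne_zero`). This is the shape of the even clause of Kato's value law (C5)
(`κ · (L 1 / Ω⁺_f) · R⁻_{χ̄}`) with the transcendental period REMOVED: the quotient is the algebraic number
`P_{χ̄}(1) · (Σ χ(a)[a/m]⁺_f) / τ(χ) ∈ ℚ(χ)`. [cite: MazurTateTeitelbaum1986Invent, §I.8 (8.6)] [cite: Kato2004Asterisque, Thm. 6.6 (1) (p. 163)] -/
theorem apply_one_div_plusPeriod_eq (hf : IsNewform0 f) (hQ : coeffField f = ⊥) {m M : ℕ} [NeZero m]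
    [NeZero M] {χ : DirichletCharacter ℂ m} (hχ : χ.IsPrimitive) (hχe : χ.Even) {L : ℂ → ℂ}
    (hL : IsDepletedTwistedL f m M χ⁻¹ L) (hΩ : (plusPeriod f : ℂ) ≠ 0) :
    L 1 / (plusPeriod f : ℂ) =
      (∏ ℓ ∈ (m * M).primeFactors.filter (fun ℓ => ¬ ℓ ∣ m),
        (1 - χ⁻¹ (ℓ : ZMod m) * cuspCoeff f ℓ * (ℓ : ℂ) ^ (-(1 : ℂ)) +
          (if ℓ ∣ N then 0 else (ℓ : ℂ)) * χ⁻¹ (ℓ : ZMod m) ^ 2 * ((ℓ : ℂ) ^ (-(1 : ℂ))) ^ 2)) *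
        ratTwistedSymbolSum f χ / gaussSum χ (ZMod.stdAddChar (N := m)) := by
  have hτ := Literature.NumberTheory.LFunctions.gaussSum_ne_zero χ hχ
  have h := gaussSum_mul_apply_one_eq_of_even hf hQ hχ hχe hL
  rw [div_eq_div_iff hΩ hτ]
  linear_combination h

/-- **(C5)-currency, odd parity**: `L 1 / (i · Ω⁻_f) = P_{χ̄}(1) · (Σ_a χ(a)[a/m]⁻_f) / τ(χ)` for ANY `M`-depleted continuation
`L` of the series of `χ̄`, `χ` odd primitive mod `m`, `Ω⁻_f ≠ 0` — the shape of the odd clause of (C5)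
(`−κ · (L 1 / (i Ω⁻_f)) · R⁺_{χ̄}`) with the period removed. [cite: MazurTateTeitelbaum1986Invent, §I.8 (8.6)]
[cite: Kato2004Asterisque, Thm. 6.6 (1) (p. 163)] -/
theorem apply_one_div_I_mul_minusPeriod_eq (hf : IsNewform0 f) (hQ : coeffField f = ⊥) {m M : ℕ} [NeZero m]
    [NeZero M] {χ : DirichletCharacter ℂ m} (hχ : χ.IsPrimitive) (hχo : χ.Odd) {L : ℂ → ℂ}
    (hL : IsDepletedTwistedL f m M χ⁻¹ L) (hΩ : (minusPeriod f : ℂ) ≠ 0) :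
    L 1 / (Complex.I * (minusPeriod f : ℂ)) =
      (∏ ℓ ∈ (m * M).primeFactors.filter (fun ℓ => ¬ ℓ ∣ m),
        (1 - χ⁻¹ (ℓ : ZMod m) * cuspCoeff f ℓ * (ℓ : ℂ) ^ (-(1 : ℂ)) +
          (if ℓ ∣ N then 0 else (ℓ : ℂ)) * χ⁻¹ (ℓ : ZMod m) ^ 2 * ((ℓ : ℂ) ^ (-(1 : ℂ))) ^ 2)) *
        ratMinusTwistedSymbolSum f χ / gaussSum χ (ZMod.stdAddChar (N := m)) := by
  have hτ := Literature.NumberTheory.LFunctions.gaussSum_ne_zero χ hχ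
  have hI : Complex.I ≠ 0 := Complex.I_ne_zero
  have h := gaussSum_mul_apply_one_eq_of_odd hf hQ hχ hχo hL
  rw [div_eq_div_iff (mul_ne_zero hI hΩ) hτ]
  linear_combination h

end Birch

end Summit.BirchSwinnertonDyer.BirchSwinnertonDyer.Theorems.CccOneDepletedValueGlue

end
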